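import Mathlib
import HarnessLib
import HarnessLib.Audit
import Summits.NavierStokesRegularity.Statement
import Summits.NavierStokesRegularity.NavierStokesRegularity.Theorems.NoBlowupToClay
import Summits.NavierStokesRegularity.NavierStokesRegularity.Theorems.TypeILiouvilleLKillsTypeI
import Summits.NavierStokesRegularity.NavierStokesRegularity.Theorems.DSolutionBubbleTypeIISlowDoublingEternal
import HarnessLib.Audit.Status.Attr

/-!
Route: RootDecompLiouvilleHorizon

It suffices to show X = Q♭ ∧ G ∧ E♯ (lens-5 g10 «HORIZON LADDER», CRITIC-LEDGER row 113 CLEARED: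
«ROOT sound; prefer re-dock N22 over sibling» — this is that re-dock; gen 9's binders ((L), B♯, E♯)
are superseded: B♯ is now a consequence of CPT and (L) is no longer a binder). Q♭ `BlowupHorizon` =
QUANTITATIVE LIOUVILLE AT THE HORIZON OF A BLOW-UP: for every ε > 0 there is S such that every
maximal smooth Leray–Hopf solution on [0,T) from a rapidly decaying datum, bounded by M on (0,t] ×
ℝ³ with S·ν ≤ M²·t, has ν‖∇u(t)‖∞ ≤ ε·M² (an ε-LADDER `BlowupRung ε`; top rung `SmoothingRung`
THEOREM-GRADE by KNSS smoothing; ε → 0⁺ end = the KNSS Liouville conjecture (L) 10661 through the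
blow-up-free compactness CPT `HorizonCompactness`). G `TypeIGradientFloor` = the Liouville-free core
of KNSS's Type-I exclusion: a Type-I blow-up in the frame has (T − t)‖∇u(t)‖∞ ≥ c > 0 frequently
(EXPECTED THEOREM, first prover target). E♯ `NoRecordEulerianTypeII` (32033, verbatim, DECLARED
RESIDUAL): a blow-up whose core Reynolds number is unbounded along the records is Type I. Two PROVED
glue items carry the kernels: K1 `HorizonRecordKill : Q♭ → E♯ → B1` (the RESTART: rung ε empties the
Reynolds cell 4Rε < 1 along the records — arithmetic) and K2 `HorizonTypeIKill : Q♭ → G → no Type-I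
blow-up` (Q♭ flattens the scaled gradient of the Type-I rate, G forbids it).
Lean: BlowupHorizon ∧ TypeIGradientFloor ∧ NoRecordEulerianTypeII
## Assembly
S ⟸ Q♭ → G → E♯ → K1 → K2 (deciding theorem `closes`, 5/5 binders consumed: K1 turns Q♭ ∧ E♯ into
«every frame blow-up is Type I», K2 turns Q♭ ∧ G into «no frame blow-up is Type I»,
`navierStokesRegularity_of_noBlowup` concludes). EXACT AT THE ROOT: `root_iff :
NavierStokesRegularity ↔ BlowupHorizon ∧ TypeIGradientFloor ∧ NoRecordEulerianTypeII` (lens kernel;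
S ⟹ each binder by vacuity of the frame) — critic row 102's reservation «as a ROOT route the line is
STRONGER than S by (L)'s excess» is gone. Node = lens-5 g10
(HOME/decomp-ns-lens-5/HorizonLadder.lean sha256 0eb93538…, 893 lines, rc 0 / 0 sorry,
axioms(closes) = axioms(root_iff) std; card NODE-g10.md; critic probe probe/HorizonLadder_g10.lean).
Lineage: N13 RootDecompReynoldsHorizon (V 28919 ⟸ Q♭ alone, base rung 28921 ⟸ Q♭, 1217 ⟸ Q♭ ∧ G, E
28920 ⟹ E♯) ⟸ B1 TypeILiouville 0056 ⟸ gen 9 ((L), B♯, E♯; rev 0/1 of this route) ⟸ gen 10 (this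
rev). Kept items: (L) TypeIliouvilleL 10661 and B♯ RecordZoomBridge 32032 re-badged support (the ε →
0 end of the ladder and CPT's corollary), FR LateRecordsExist 32063 support (PROVED).

Rationale: WHY THIS LINE. In print (L) is credited only with excluding TYPE I blow-up (KNSS 2009 =
arXiv:0709.3599 pp. 3–4, §6 Prop 6.1; Seregin 2014 p. 114; tree 10662) and is used only
qualitatively. Gen 10 applies the lens to the Liouville object itself: the forest's Liouville door
becomes a graded, instrumentable ε-ladder (rung H(ε): «a flow bounded by M for S viscous core-times
has ν‖∇u‖∞ ≤ εM²») whose every rung has a PROVED bridge to a Reynolds cell of B1 (exchange rate 4Rε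
< 1, `noTypeII_of_rung_beyond`), whose top rung is a theorem (KNSS L∞-smoothing), whose binder form
Q♭ is S-necessary (`root_iff`), with (L) demoted to the ε → 0 end ((L) ∧ CPT ⟹ Q ⟹ Q♭) and the
Type-I use of (L) replaced by the Liouville-free gradient floor G. Imported: KNSS 2009
zoom/smoothing (tree theorems `knss2009_local_smoothing_holds`, `singularZoom_zoomLimit`,
`exists_tendsto_of_typeI_seq_Ioo`), Tao 2013 slab bounds (`exists_forall_norm_le_of_tao2011`), the
Poláčik–Quittner–Souplet doubling/compactness passage from a Liouville theorem to a universal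
quantitative estimate (doi:10.1512/iumj.2007.56.2911; semilinear, here as mechanism provenance), the
4064 eternal-extraction template.
RANKED CRUXES. r2 TypeIGradientFloor (G; EXPECTED THEOREM, ATTACKABLE NOW, FIRST PROVER TARGET, ≈
200 lines copy-adapt of the singular-zoom template with gradient convergence). r3
NoRecordEulerianTypeII (E♯ 32033; DECLARED RESIDUAL; barrier-inside Tao; instrumentable T-Re-1♯;
unchanged — honest: = Beyond ∞, no rung reaches it). r4 BlowupHorizon (Q♭; OPEN, LADDER-GRADED:
ATTACKABLE rung-by-rung, IDEA-NEEDED at ε → 0 = (L) through CPT; instrument T-anc-2 horizon curve).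
Glue (PROVED in the lens, ports pending): K1 HorizonRecordKill, K2 HorizonTypeIKill. Supports: CPT
HorizonCompactness (EXPECTED THEOREM, second prover target; gives Q from (L) and B♯ outright), Q
ClayHorizon (the S-free conjecture the ladder instruments; `closes_clay`), SmoothingRung
(THEOREM-GRADE top rung: ∃R₀ > 0, Beyond R₀ → B1), FR LateRecordsExist (PROVED), (L) 10661 and B♯
32032 (gen 9 binders, re-badged support).
KILL CRITERIA. A bounded ancient mild solution with a non-constant slice arising as a long-window
limit of finite-energy blow-ups refutes Q♭ (and (L)); a Type-I blow-up with (T−t)‖∇u(t)‖∞ → 0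
refutes G (excluded once G is proved — no candidate known); E♯ dies with a record-Eulerian Type-II
blow-up (Hou's locked scenario lies inside E♯ ∩ locked). Kill switch of the node: S ↔ Q♭ ∧ G ∧ E♯,
so any refuted binder refutes Clay (A).
NOT DECOMPOSED YET. E♯ (the residual of the whole forest on the Reynolds axis); the small-ε rungs of
Q♭ below the instrumented/proved range (residual dial `NoEulerianTypeIIBeyond R`, asides not filed:
Beyond 0 ↔ B1, Beyond R → E♯, rung ε retires R < 1/(4ε)). Rejected this gen (lens §9): rate
re-slicings of E♯ (no deciding tool either side), ℓ-dials (gens 6–8 repeats), Q over general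
classical solutions (parasitic u = c(t)), the bare implication Q → NoTypeIBlowup (costume → replaced
by G), (L) as a binder next to Q (redundant), CPT via the Type-I extraction (hypothesis fails for
bounded sequences), G from BKM (insufficient), intermediate rungs as items (constant-chasing).
CHEAPEST FALSIFIER. For G: check that `exists_tendsto_of_typeI_seq_Ioo` delivers pointwise
convergence of fderiv (it does per its statement; if only C⁰, G needs the k = 2 smoothing first).
For Q♭/Q: instrument T-anc-2 — the horizon curve g(S) on stored K8/K26 caricature trajectories; a
plateau g(S) ≥ g_* > 0 from true NS would exhibit the stalled rung (and a candidate non-Liouville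
ancient profile). For the line: T-Re-1♯ (record Reynolds number) — record-viscous models make E♯
vacuous there.

Novelty: Searches RUN (lens-5 g9 + writer): lit search --hybrid "Liouville conjecture bounded ancient mild
solution Type II blow-up" / "KNSS Liouville rules out Type I" [corpus:paper:arxiv-0709.3599 pp. 3–4,
§6 pp. 11–12 Lemma 6.1;
corpus:book:seregin2014-lecture-notes-regularity-theory-navier-stokes-equations pp. 109–114]; lit
galaxy search "Liouville|ancient solution|Type II" --star all (no hit placing (L) against Type II
beyond the axisymmetric |u| ≤ C/r case); lean search 'LiouvilleConjectureNS' (tree: 10661/10662,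
knss_axisym strata, 4064 PROVED plateau limit); rg over Theses/ for
RecordViscous|Reynolds|near-record (only N13 RootDecompReynoldsHorizon 28919–28921). Nearest prior
art: KNSS 2009 (arXiv:0709.3599) — (L) ⟹ no Type I (velocity-max zoom); Seregin–Šverák Type-II zoom
to a plateau (tree 4064); N13's Reynolds-horizon split V/E with base rung R ≤ ε. Delta: the zoom is
centred at the GRADIENT WITNESS of a near-record R-viscous point, so the dimensionless bound Re_core
≤ R survives as a gradient floor and (L) excludes record-viscous TYPE-II blow-ups at every finite R
at once — a use of (L) absent from print and from the tree. Claimed grade: new-combination (lens) /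
modest-plus (critic row 102).  [refs: 0709.3599, paper:arxiv-0709.3599, book:seregin2014-lecture-notes-regularity-theory-navier-stokes-equations]

Barriers (technique_class: blow-up-zoom liouville compactness knss-smoothing reynolds): - technique_class: blow-up-zoom liouville compactness knss-smoothing reynolds
- Literature.Barriers.NavierStokesRegularity.TaoAveragedBlowup: B♯ and (L)-side do not engage it (B♯
is a compactness statement; (L) is an exact-NS Liouville conjecture whose averaged analogue is not
claimed); E♯ sits INSIDE its scope (a record-Eulerian cascade is what Tao's averaged blow-up looks
like on this axis) — it does not evade; the bet is that E♯ is the honest residual, declared and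
exempt, to be cut by finer NS structure later.
- Literature.Barriers.NavierStokesRegularity.EnergySupercriticality: outside — every quantity is
dimensionless (core Reynolds number, rescaled gradient floor); no energy-class closing estimate.
- Literature.Barriers.NavierStokesRegularity.NSITypeIIBlowup: evaded by currency — B♯'s output and
(L)'s input are ancient MILD solutions; NSI fields are not mild.
- Literature.Barriers.NavierStokesRegularity.AxisymmetricTypeIExclusion: not engaged (no symmetry
hypothesis); the axisymmetric stratum of (L) is a known theorem (tree knss_axisym*), consistent.
- Literature.Barriers.NavierStokesRegularity.AveragedTypeIBlowup: the Type-I-exclusion step of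
`closes` is NOT a rescaling/compactness argument of the route — it is the tree theorem 10662 ((L) ⟹
no Type I), and (L) itself is an exact-NS Liouville statement posed as a CRUX (an averaged Euler
bilinear form B̃ may well carry bounded ancient mild solutions with non-constant slices — the route
does not claim (L) for averaged equ

History (route lifecycle, newest last):
- 2026-08-30T10:15:20Z · rev 1: informal re-worded for Assembly (planner-decomp-ns-writer-1-g4-0)

sub-problem: NavierStokesRegularity · status: draft · opened planner-decomp-ns-writer-1-g4-0 2026-08-30T10:08:46Z · rev 4 · ledger route-NavierStokesRegularity-RootDecompLiouvilleHorizon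
GENERATED by the gate from the ledger (D-0016/17). Provers cite these decls: `theorem foo : Summit.NavierStokesRegularity.NavierStokesRegularity.Theses.RootDecompLiouvilleHorizon.<Decl> := …` in Summits/NavierStokesRegularity/NavierStokesRegularity/Theorems/<Name>.lean.
-/

namespace Summit.NavierStokesRegularity.NavierStokesRegularity.Theses.RootDecompLiouvilleHorizon

open scoped BigOperators Topology Manifold Classical MeasureTheory ProbabilityTheory Matrix InnerProductSpace ComplexConjugate ContinuousMap
open Filter Set Function TopologicalSpace MeasureTheory

attribute [summit_statement] _root_.NavierStokesRegularity

open Literature.NS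

/-- item stmt-NavierStokesRegularity-32316 · crux · rank 2 · closed · proved by Summit.NavierStokesRegularity.NavierStokesRegularity.Theorems.RootDecompLiouvilleHorizonTypeIGradientFloor.typeIGradientFloor_proof (planner) · by planner
why it might fail: none known mathematically; BKM-type non-integrability of ‖∇u‖∞ does NOT give it (o(1/(T−t)) is compatible with a divergent integral) — the zoom is needed; risk = size/typing of the gradient convergence
sources: KochNadirashviliSereginSverak2009, SereginSverak2009, arXiv:1610.05680, Tsai1998
[crux] G · TYPE-I GRADIENT FLOOR (lens-5 g10 «HORIZON LADDER», CRITIC-LEDGER row 113 CLEARED;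
re-dock of N22: binder of the new `closes`). A maximal smooth Leray–Hopf solution on [0,T) from a
rapidly decaying datum which blows up at the Type-I rate has, for some c > 0, (T − t)·‖∇u(t)(y)‖ ≥ c
at some point y at times arbitrarily close to T. EXPECTED THEOREM · ATTACKABLE NOW · FIRST PROVER
TARGET · WEAKER than S (vacuity of the frame) · G ⟸ 1217 NoTypeIBlowup ⟸ (L) (lens kernels
`typeIGradientFloor_of_noTypeIBlowup`, `typeIGradientFloor_of_L`) · the LIOUVILLE-FREE CORE of
KNSS's Type-I exclusion. Template: `Theorems.singularZoom_zoomLimit` (PROVED) +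
`Theorems.exists_tendsto_of_typeI_seq_Ioo` (pointwise convergence of the zoomed GRADIENTS, PROVED) +
`IsTypeIAncientMild.eq_zero_of_slice_const`: if (T−t)‖∇u(t)‖∞ → 0 every slice of the singular zoom
limit ū ∈ 𝒦_C has zero gradient, so ū ≡ 0, contradicting «unbounded at the origin» (≈ 200 lines
copy-adapt). Separating world (G ∧ E♯ ∧ ¬Q♭ ∧ ¬S): a record-viscous breathing Type-II blow-up. BC7
CLEAN (lens probe-g10). Sources: KNSS2009 arXiv:0709.3599 §6 Prop 6.1 / Lemma 6.1;
AlbrittonBarker2019 §3; Seregin2014 p.114. Why it might fail: non -/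
@[route_item "route-NavierStokesRegularity-RootDecompLiouvilleHorizon", crux]
def TypeIGradientFloor : Prop :=
  ∀ (ν T : ℝ), 0 < ν → 0 < T → ∀ (u : ℝ → EuclideanSpace ℝ (Fin 3) → EuclideanSpace ℝ (Fin 3)) (p : ℝ → EuclideanSpace ℝ (Fin 3) → ℝ), Literature.Analysis.FluidPDE.IsMaximalSmoothSolution ν 0 u p T → Literature.Analysis.FluidPDE.IsLerayHopfOn T ν 0 (u 0) u → Literature.Analysis.FluidPDE.HasRapidSpatialDecay (u 0) → Literature.Analysis.FluidPDE.IsTypeIBlowup u T → ∃ c : ℝ, 0 < c ∧ ∃ᶠ t in nhdsWithin T (Set.Iio T), ∃ y : EuclideanSpace ℝ (Fin 3), c ≤ (T - t) * ‖fderiv ℝ (u t) y‖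

-- `TypeIGradientFloor` holds: proved by `Summit.NavierStokesRegularity.NavierStokesRegularity.Theorems.RootDecompLiouvilleHorizonTypeIGradientFloor.typeIGradientFloor_proof` (its module imports this route file, so no `_holds` link can be stated here).

/-- item stmt-NavierStokesRegularity-32033 · crux · rank 3 · open · by planner
why it might fail: A record-Eulerian Type-II blow-up — Re_core → ∞ along the records, e.g. Hou's locked scenario or a Tao-type cascade realised by true NS — violates it; nothing in print constrains this class (it is where the averaged-equation barrier lives).
sources: Tao2016AveragedNS, Hou2022PotentiallySingularNS, arXiv:0709.3599, SereginSverak2009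
[crux] E♯ NO RECORD-EULERIAN TYPE-II BLOW-UP · NEW · DECLARED RESIDUAL · WEAKER than B1 NoTypeII
0056 (drop a hypothesis) and than N13's E NoEulerianTypeII 28920 (lens kernel
`noRecordEulerianTypeII_of_noEulerianTypeII`; converse fails: the BREATHING world — Eulerian i.o.
but viscous along a record subsequence — is now (L)-covered) · BARRIER-INSIDE (TaoAveragedBlowup) ·
IDEA-NEEDED · INSTRUMENTABLE (T-Re-1♯: core Reynolds number along the records of the census
cascades; caricature proxy ρ = ν max k|u_n| / max|u_n|²) · contains Hou's locked cell (lens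
`noLockedTypeII_of_noEulerianTypeII`: a locked Type-II blow-up is Eulerian): a maximal smooth
Leray–Hopf solution from a rapidly decaying datum whose core Reynolds number is UNBOUNDED ALONG THE
RECORDS (for every R, at all late times, no near-record fast point is R-viscous) blows up at most at
the Type-I rate. Tags: WEAKER · RESIDUAL · BARRIER. [deps: none] [difficulty: open-problem] -/
@[route_item "route-NavierStokesRegularity-RootDecompLiouvilleHorizon", crux]
def NoRecordEulerianTypeII : Prop :=
  ∀ (ν T : ℝ), 0 < ν → 0 < T → ∀ (u : ℝ → EuclideanSpace ℝ (Fin 3) → EuclideanSpace ℝ (Fin 3)) (p : ℝ → EuclideanSpace ℝ (Fin 3) → ℝ), Literature.Analysis.FluidPDE.IsMaximalSmoothSolution ν 0 u p T → Literature.Analysis.FluidPDE.IsLerayHopfOn T ν 0 (u 0) u → Literature.Analysis.FluidPDE.HasRapidSpatialDecay (u 0) → ¬ (∃ R : ℝ, ∃ᶠ t in nhdsWithin T (Set.Iio T), ∃ x : EuclideanSpace ℝ (Fin 3), 1 ≤ ‖u t x‖ ∧ (∀ s ∈ Set.Ioc 0 t, ∀ y : EuclideanSpace ℝ (Fin 3),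 ‖u s y‖ ≤ 2 * ‖u t x‖) ∧ ∃ y : EuclideanSpace ℝ (Fin 3), ‖u t x‖ ^ 2 ≤ R * ν * ‖fderiv ℝ (u t) y‖) → Literature.Analysis.FluidPDE.IsTypeIBlowup u T

/-- item stmt-NavierStokesRegularity-32317 · crux · rank 4 · open · by planner
why it might fail: exactly if (L) fails with a Clay-shadowable counterexample — a non-constant bounded ancient mild solution arising as a long-window limit of finite-energy blow-ups; as a binder it is S-necessary, so it cannot fail where S holds
sources: KochNadirashviliSereginSverak2009, EscauriazaSereginSverak2003, arXiv:1610.05680, SereginSverak2009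
[crux] Q♭ · QUANTITATIVE LIOUVILLE AT THE HORIZON OF A BLOW-UP (lens-5 g10 «HORIZON LADDER», row
113; binder of the new `closes`). For every ε > 0 there is S such that every maximal smooth
Leray–Hopf solution on [0,T) from a rapidly decaying datum, bounded by M on (0,t] × ℝ³ (t < T) with
S·ν ≤ M²·t, has ν‖∇u(t)(y)‖ ≤ ε·M² for all y (= ∀ ε, BlowupRung ε). NEW · WEAKER than S (S ⟹ Q♭ by
vacuity of the frame; separating world: record-Eulerian cascade with Liouville-flat windows) · BELOW
(L): Q♭ ⟸ Q `ClayHorizon` ⟸ (L) 10661 ∧ CPT `HorizonCompactness` (lens kernels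
`blowupHorizon_of_clayHorizon`, `clayHorizon_of_L_compactness`, PROVED) · OPEN · LADDER-GRADED (rung
ε retires the Reynolds cells R < 1/(4ε) of B1, `noTypeII_of_rung_beyond`; top rung `SmoothingRung`
THEOREM-GRADE gives ∃R₀>0, Beyond R₀ → B1) · ATTACKABLE rung-by-rung, IDEA-NEEDED at ε → 0 (= the
KNSS Liouville conjecture through CPT) · with Q♭ the node is EXACT AT THE ROOT: `root_iff : S ↔ Q♭ ∧
G ∧ E♯` (kernel; answers critic row 102 «stronger than S by (L)'s excess»). Instrument T-anc-2:
horizon curve g(S). BC7 CLEAN. Sources: KNSS2009 arXiv:0709.3599 §1 conjecture (L), §6 Prop 6.1;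
Seregin2014 p.111 Prop 3.10, p.113; Polá -/
@[route_item "route-NavierStokesRegularity-RootDecompLiouvilleHorizon", crux]
def BlowupHorizon : Prop :=
  ∀ ε : ℝ, 0 < ε → ∃ S : ℝ, 0 < S ∧ ∀ (ν T : ℝ), 0 < ν → 0 < T → ∀ (u : ℝ → EuclideanSpace ℝ (Fin 3) → EuclideanSpace ℝ (Fin 3)) (p : ℝ → EuclideanSpace ℝ (Fin 3) → ℝ), Literature.Analysis.FluidPDE.IsMaximalSmoothSolution ν 0 u p T → Literature.Analysis.FluidPDE.IsLerayHopfOn T ν 0 (u 0) u → Literature.Analysis.FluidPDE.HasRapidSpatialDecay (u 0) → ∀ t ∈ Set.Ioo 0 T, ∀ M : ℝ, S * ν ≤ M ^ 2 * t → (∀ s ∈ Set.Ioc 0 t, ∀ y : EuclideanSpace ℝ (Fin 3), ‖u s y‖ ≤ M) → ∀ y : EuclideanSpace ℝ (Fin 3), ν * ‖fderiv ℝ (u t) y‖ ≤ ε * M ^ 2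

/-- item stmt-NavierStokesRegularity-32032 · support · rank 2 · open · by planner
why it might fail: No mathematical gap known; the one new formal step is passing fderiv to the limit (Arzelà–Ascoli on gradients from the uniform C² bound — the 4064 extraction is C⁰-level); if the tree's KNSS smoothing constant depends on more than the L^∞ bound the floor is lost. Risk = size.
sources: KochNadirashviliSereginSverak2009, arXiv:0709.3599, book:seregin2014-lecture-notes-regularity-theory-navier-stokes-equations, SereginSverak2009
[crux] B♯ RECORD-ZOOM BRIDGE · NEW · EXPECTED THEOREM · ATTACKABLE NOW (first prover target) ·
WEAKER than S (vacuity) · a maximal smooth Leray–Hopf solution on [0,T) from a rapidly decaying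
datum which is R-viscous (‖u(t,x)‖² ≤ R·ν·‖∇u(t)(y)‖ for some y) at near-record fast points (the
whole past bounded by twice the speed) at times arbitrarily close to T generates — by the KNSS zoom
V_n(s,z) = N_n⁻¹·w₁(νt_n + s/N_n², y_n + z/N_n) CENTRED AT THE GRADIENT WITNESS y_n — a bounded
ancient mild solution w (ν = 1) with measurable slices ONE OF WHICH IS NOT A.E. CONSTANT. Skeleton
(all tree theorems): near-records `exists_near_max`; |V_n| ≤ 2 on the past; dimensionless floor
|∇V_n(0,0)| ≥ 1/R; uniform C² and ∂ₛ bounds from `knss2009_local_smoothing_holds` (k ≤ 2, l ≤ 1) ⟹ a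
velocity oscillation ≥ c(R) at distance h(R) on [−s₀(R), 0]; locally uniform extraction as in the
PROVED Type-II twin stmt-4064
(`Theorems.DSolutionBubbleTypeIISlowDoublingEternalExtraction.exists_eternal_limit`,
`eternal_of_oseen`, `lipschitz_interior_of_memLp`), slab bounds `exists_forall_norm_le_of_tao2011`,
`hasSmoothExtensionPast_of_bounded_holds`. BC5 rung BY NAME: closed item stmt-4064
`dSolutionBubble_typeIIS -/
@[route_item "route-NavierStokesRegularity-RootDecompLiouvilleHorizon"]
def RecordZoomBridge : Prop :=
  ∀ (ν T : ℝ), 0 < ν → 0 < T → ∀ (u : ℝ → EuclideanSpace ℝ (Fin 3) → EuclideanSpace ℝ (Fin 3)) (p : ℝ → EuclideanSpace ℝ (Fin 3) → ℝ), Literature.Analysis.FluidPDE.IsMaximalSmoothSolution ν 0 u p T → Literature.Analysis.FluidPDE.IsLerayHopfOn T ν 0 (u 0) u → Literature.Analysis.FluidPDE.HasRapidSpatialDecay (u 0) → (∃ R : ℝ, ∃ᶠ t in nhdsWithin T (Set.Iio T), ∃ x : EuclideanSpace ℝ (Fin 3), 1 ≤ ‖u t x‖ ∧ (∀ s ∈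 Set.Ioc 0 t, ∀ y : EuclideanSpace ℝ (Fin 3), ‖u s y‖ ≤ 2 * ‖u t x‖) ∧ ∃ y : EuclideanSpace ℝ (Fin 3), ‖u t x‖ ^ 2 ≤ R * ν * ‖fderiv ℝ (u t) y‖) → ∃ w : ℝ → EuclideanSpace ℝ (Fin 3) → EuclideanSpace ℝ (Fin 3), Literature.Analysis.FluidPDE.IsBoundedAncientMildSolution 1 w ∧ (∀ t < 0, MeasureTheory.AEStronglyMeasurable (w t) MeasureTheory.volume) ∧ ∃ t : ℝ, t < 0 ∧ ¬ ∃ b : EuclideanSpace ℝ (Fin 3), w t =ᵐ[MeasureTheory.volume] fun _ => b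

/-- item stmt-NavierStokesRegularity-10661 · support · rank 4 · open · by planner
why it might fail: KNSS's Liouville conjecture is open beyond the axisymmetric strata; a bounded ancient mild solution with a non-constant slice (e.g. a 3D travelling/rotating wave-type ancient solution) would refute it and every door route with it.
sources: KochNadirashviliSereginSverak2009, arXiv:0709.3599, SereginSverak2009
[crux] KNSS Liouville conjecture (L), verbatim: every bounded ancient mild solution u of
Navier–Stokes (ν = 1) on ℝ³ × (−∞,0) (duality-form class
`Literature.Analysis.FluidPDE.IsBoundedAncientMildSolution 1 u`) with a.e.-strongly measurable
slices is spatially constant on every slice t < 0 (u t = b a.e.). DEFINITIONALLY EQUAL to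
`Literature.Analysis.FluidPDE.LiouvilleConjectureNS` (`Iff.rfl`, checked); inlined at rev 2
(route-repair) so that the open conjecture is carried by the route as this ITEM (to be proved or
refuted) and not as a cite-only Literature leaf of the cone, which had made the route unstaffable. A
proof or refutation here settles stmt-0057 (`LiouvilleConjectureNS`, shared with CoreLogGas /
VorticityPace) by `Iff.rfl`, and conversely. Open (KNSS2009 §1: 'completely open … even in the
steady-state case'; Seregin 2014 lecture notes p.113); known cases: 2-D (KNSS Thm 5.1), axisymmetric
no swirl (Thm 5.2 = `knss_axisymmetric_no_swirl`), r|u| ≤ C (Thm 5.3 = `knss_bound_C_over_r`),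
LeiZhang2011; consequences already in tree: `LiouvilleConjectureNS.slices_ae_eq_zero_of_typeIBound`,
`LiouvilleConjectureNS.not_nontrivialMildAncientTypeIExists_measurable` ((L) + Type I bound ⇒ -/
@[route_item "route-NavierStokesRegularity-RootDecompLiouvilleHorizon"]
def TypeIliouvilleL : Prop :=
  ∀ u : ℝ → EuclideanSpace ℝ (Fin 3) → EuclideanSpace ℝ (Fin 3), Literature.Analysis.FluidPDE.IsBoundedAncientMildSolution 1 u → (∀ t < 0, MeasureTheory.AEStronglyMeasurable (u t) MeasureTheory.volume) → ∀ t < 0, ∃ b : EuclideanSpace ℝ (Fin 3), u t =ᵐ[MeasureTheory.volume] fun _ => b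

/-- item stmt-NavierStokesRegularity-32063 · support · rank 9 · closed · proved by Summit.NavierStokesRegularity.NavierStokesRegularity.Theorems.RootDecompLiouvilleHorizonLateRecords.lateRecordsExist_holds (planner) · by planner
[support] FR LATE RECORDS EXIST · PROVED in the lens (`lateRecordsExist_proof`, kernel-closed:
boundedness on closed slabs via `exists_forall_norm_le_of_tao2011`, unboundedness up to T, selection
`exists_near_max`) — landable now as a Theorems file: in the frame, near-record fast points (1 ≤
‖u(t,x)‖, whole past ≤ 2‖u(t,x)‖) occur at times arbitrarily close to T. Used by B♯'s skeleton and
by `recordViscous_of_eventually_viscous` (N13's viscous hypothesis + FR ⟹ H♯). [difficulty: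
provable-now] -/
@[route_item "route-NavierStokesRegularity-RootDecompLiouvilleHorizon"]
def LateRecordsExist : Prop :=
  ∀ (ν T : ℝ), 0 < ν → 0 < T → ∀ (u : ℝ → EuclideanSpace ℝ (Fin 3) → EuclideanSpace ℝ (Fin 3)) (p : ℝ → EuclideanSpace ℝ (Fin 3) → ℝ), Literature.Analysis.FluidPDE.IsMaximalSmoothSolution ν 0 u p T → Literature.Analysis.FluidPDE.IsLerayHopfOn T ν 0 (u 0) u → Literature.Analysis.FluidPDE.HasRapidSpatialDecay (u 0) → ∃ᶠ t in nhdsWithin T (Set.Iio T), ∃ x : EuclideanSpace ℝ (Fin 3), 1 ≤ ‖u t x‖ ∧ ∀ s ∈ Set.Ioc 0 t, ∀ y : EuclideanSpace ℝ (Fin 3), ‖u s y‖ ≤ 2 * ‖u t x‖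

-- `LateRecordsExist` holds: proved by `Summit.NavierStokesRegularity.NavierStokesRegularity.Theorems.RootDecompLiouvilleHorizonLateRecords.lateRecordsExist_holds` (its module imports this route file, so no `_holds` link can be stated here).

/-- item stmt-NavierStokesRegularity-32318 · support · rank 9 · closed · proved by Summit.NavierStokesRegularity.NavierStokesRegularity.Theorems.RootDecompLiouvilleHorizonRecordKill.horizonRecordKill_holds (planner) · by planner
[glue] K1 · THE RESTART (PROVED in the lens, `HorizonLadder.noTypeII_of_blowupHorizon_record` ←
`not_recordViscous_of_blowupHorizon` ← `not_frequently_viscous_of_rung` + frame lemmas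
`slab_bounded`/`exists_viscous_record_window`; 0 sorry, axioms std per critic row 113; writer
evidence `LadderGlue.k1_holds`): Q♭ and the residual E♯ give B1 (every maximal smooth Leray–Hopf
blow-up in the frame is Type I): under rung ε a blow-up is NOT R-viscous at a record subsequence for
any R with 4Rε < 1 — at a late near-record (t,x) the window (0,t] has Sν ≤ (2‖u(t,x)‖)²t, so H(ε)
gives ν‖∇u(t)‖∞ ≤ 4ε‖u(t,x)‖², while an R-viscous witness gives ‖u(t,x)‖² ≤ Rν‖∇u(t)(y)‖ ≤
4Rε‖u(t,x)‖² < ‖u(t,x)‖²; E♯ makes the non-record-viscous blow-up Type I. Binder of the new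
`closes`; landing = port of ≈ 120 lens lines into Theorems (routine). -/
@[route_item "route-NavierStokesRegularity-RootDecompLiouvilleHorizon", crux]
def HorizonRecordKill : Prop :=
  BlowupHorizon → NoRecordEulerianTypeII → ∀ (ν T : ℝ), 0 < ν → 0 < T → ∀ (u : ℝ → EuclideanSpace ℝ (Fin 3) → EuclideanSpace ℝ (Fin 3)) (p : ℝ → EuclideanSpace ℝ (Fin 3) → ℝ), Literature.Analysis.FluidPDE.IsMaximalSmoothSolution ν 0 u p T → Literature.Analysis.FluidPDE.IsLerayHopfOn T ν 0 (u 0) u → Literature.Analysis.FluidPDE.HasRapidSpatialDecay (u 0) → Literature.Analysis.FluidPDE.IsTypeIBlowup u T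

-- `HorizonRecordKill` holds: proved by `Summit.NavierStokesRegularity.NavierStokesRegularity.Theorems.RootDecompLiouvilleHorizonRecordKill.horizonRecordKill_holds` (its module imports this route file, so no `_holds` link can be stated here).

/-- item stmt-NavierStokesRegularity-32319 · support · rank 9 · closed · proved by Summit.NavierStokesRegularity.NavierStokesRegularity.Theorems.RootDecompLiouvilleHorizonKills.horizonTypeIKill_proof (planner) · by planner
[glue] K2 · THE TYPE-I SIDE WITHOUT (L) (PROVED in the lens,
`HorizonLadder.not_typeI_of_blowupHorizon_floor`, ≈ 110 lines, 0 sorry; writer evidence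
`LadderGlue.k2_holds`): Q♭ and the gradient floor G exclude Type-I blow-up in the frame — Q♭ on the
windows (0,t] with the past bound M_t = M₀ + (|C|+1)/√(T−t) (slab bound
`exists_forall_norm_le_of_tao2011` + the Type-I rate) gives (T−t)‖∇u(t)‖∞ ≤ 4ε(|C|+1)²/ν eventually,
for every ε; G gives ≥ c frequently; the rung needed is ε < cν/(4(|C|+1)²). Binder of the new
`closes`; landing = port into Theorems (routine). Hence Q♭ ∧ G ⟹ 1217 NoTypeIBlowup (either tree
typing, lens `noTypeIBlowup_of_blowupHorizon_floor`). -/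
@[route_item "route-NavierStokesRegularity-RootDecompLiouvilleHorizon", crux]
def HorizonTypeIKill : Prop :=
  BlowupHorizon → TypeIGradientFloor → ∀ (ν T : ℝ), 0 < ν → 0 < T → ∀ (u : ℝ → EuclideanSpace ℝ (Fin 3) → EuclideanSpace ℝ (Fin 3)) (p : ℝ → EuclideanSpace ℝ (Fin 3) → ℝ), Literature.Analysis.FluidPDE.IsMaximalSmoothSolution ν 0 u p T → Literature.Analysis.FluidPDE.IsLerayHopfOn T ν 0 (u 0) u → Literature.Analysis.FluidPDE.HasRapidSpatialDecay (u 0) → ¬ Literature.Analysis.FluidPDE.IsTypeIBlowup u T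

-- `HorizonTypeIKill` holds: proved by `Summit.NavierStokesRegularity.NavierStokesRegularity.Theorems.RootDecompLiouvilleHorizonKills.horizonTypeIKill_proof` (its module imports this route file, so no `_holds` link can be stated here).

/-- item stmt-NavierStokesRegularity-32320 · support · rank 9 · closed · proved by Summit.NavierStokesRegularity.NavierStokesRegularity.Theorems.RootDecompLiouvilleHorizonHorizonCompactness.horizonCompactness_proof (planner) · by planner
[support] CPT · HORIZON COMPACTNESS (lens-5 g10; EXPECTED THEOREM · ATTACKABLE NOW · SECOND PROVER
TARGET · blow-up-free). If, for one ε > 0, the rung H(ε) fails on windows of EVERY length S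
(Clay-class solutions u_S bounded by M_S on (0,t_S] with S ν_S ≤ M_S² t_S and a point where
ν_S‖∇u_S(t_S)‖ > ε M_S²), then there is a bounded ancient mild solution (ν = 1) with measurable
slices one of which is NOT a.e. constant. Role: (L) 10661 ∧ CPT ⟹ Q `ClayHorizon` ⟹ Q♭ (kernels
`clayHorizon_of_L_compactness`, `blowupHorizon_of_clayHorizon`) and CPT ⟹ B♯ 32032
(`recordZoomBridge_of_compactness`) — the BC3 skeleton of Q♭. Skeleton: rescale u_S to M = ν = 1
centred at the gradient witness; |·| ≤ 1 on a backward window of length ≥ S → ∞; uniform C² bounds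
(`knss2009_local_smoothing_holds`, k ≤ 2) on the last unit of time; extraction (tree twin, C⁰-level:
`Theorems.…TypeIISlowDoublingEternalExtraction.exists_eternal_limit`; gradient-level Type-I twin
`Theorems.exists_tendsto_of_typeI_seq_Ioo`) keeping |∇w(0,0)| ≥ ε. Why it might fail: no
mathematical gap known; the formal step not yet in tree is Arzelà–Ascoli on gradients in the bounded
(non-Type-I) setting; risk = size. Sources: Seregin2014 p. -/
@[route_item "route-NavierStokesRegularity-RootDecompLiouvilleHorizon", crux]
def HorizonCompactness : Prop :=
  ∀ ε : ℝ, 0 < ε → (∀ S : ℝ, 0 < S → ∃ ν T : ℝ, 0 < ν ∧ 0 < T ∧ ∃ (u : ℝ → EuclideanSpace ℝ (Fin 3) → EuclideanSpace ℝ (Fin 3)) (p : ℝ → EuclideanSpace ℝ (Fin 3) → ℝ), Literature.Analysis.FluidPDE.IsClassicalNSSolutionOn (Set.Ico 0 T) ν 0 u p ∧ Literature.Analysis.FluidPDE.IsLerayHopfOn T ν 0 (u 0) u ∧ Literature.Analysis.FluidPDE.HasRapidSpatialDecay (u 0) ∧ ∃ t ∈ Set.Ioo 0 T, ∃ M : ℝ,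 S * ν ≤ M ^ 2 * t ∧ (∀ s ∈ Set.Ioc 0 t, ∀ y : EuclideanSpace ℝ (Fin 3), ‖u s y‖ ≤ M) ∧ ∃ y : EuclideanSpace ℝ (Fin 3), ε * M ^ 2 < ν * ‖fderiv ℝ (u t) y‖) → ∃ w : ℝ → EuclideanSpace ℝ (Fin 3) → EuclideanSpace ℝ (Fin 3), Literature.Analysis.FluidPDE.IsBoundedAncientMildSolution 1 w ∧ (∀ t < 0, MeasureTheory.AEStronglyMeasurable (w t) MeasureTheory.volume) ∧ ∃ t : ℝ, t < 0 ∧ ¬ ∃ b : EuclideanSpace ℝ (Fin 3), w t =ᵐ[MeasureTheory.volume] fun _ => b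

-- `HorizonCompactness` holds: proved by `Summit.NavierStokesRegularity.NavierStokesRegularity.Theorems.RootDecompLiouvilleHorizonHorizonCompactness.horizonCompactness_proof` (its module imports this route file, so no `_holds` link can be stated here).

/-- item stmt-NavierStokesRegularity-32321 · support · rank 9 · open · by planner
[support] Q · QUANTITATIVE LIOUVILLE AT THE HORIZON, CLAY CLASS (lens-5 g10; NEW · S-FREE (hence NOT
a binder) · OPEN · the conjecture the ladder instruments; MEET-adjacent to (L) 10661: Q ⟸ (L) ∧ CPT
(`clayHorizon_of_L_compactness`), formally below (L) — the converse needs finite-energy shadowing).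
For every ε > 0 there is S such that every Clay-class solution (classical on [0,T), Leray–Hopf from
its rapidly decaying datum; no blow-up, no maximality assumed) bounded by M on (0,t] × ℝ³ with S·ν ≤
M²·t has ν‖∇u(t)(y)‖ ≤ ε·M² for all y (= ∀ ε, HorizonRung ε). Q ⟹ Q♭
(`blowupHorizon_of_clayHorizon`, writer Sketch), Q ⟹ SmoothingRung; `closes_clay : Q → G → E♯ → S`
(lens). Instrument T-anc-2 (horizon curve). Typed over the Clay class because over general classical
solutions the parasitic u = c(t), p = −c'·x (Seregin p.113) refutes it. Sources: KNSS2009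
arXiv:0709.3599 §1, §6 Prop 6.1; Seregin2014 p.111 Prop 3.10, p.113 Conjecture; PQS
doi:10.1512/iumj.2007.56.2911. -/
@[route_item "route-NavierStokesRegularity-RootDecompLiouvilleHorizon", crux]
def ClayHorizon : Prop :=
  ∀ ε : ℝ, 0 < ε → ∃ S : ℝ, 0 < S ∧ ∀ (ν T : ℝ), 0 < ν → 0 < T → ∀ (u : ℝ → EuclideanSpace ℝ (Fin 3) → EuclideanSpace ℝ (Fin 3)) (p : ℝ → EuclideanSpace ℝ (Fin 3) → ℝ), Literature.Analysis.FluidPDE.IsClassicalNSSolutionOn (Set.Ico 0 T) ν 0 u p → Literature.Analysis.FluidPDE.IsLerayHopfOn T ν 0 (u 0) u → Literature.Analysis.FluidPDE.HasRapidSpatialDecay (u 0) → ∀ t ∈ Set.Ioo 0 T, ∀ M : ℝ, S * ν ≤ M ^ 2 * t → (∀ s ∈ Set.Ioc 0 t, ∀ y : EuclideanSpace ℝ (Fin 3), ‖u s y‖ ≤ M) → ∀ y : EuclideanSpace ℝ (Fin 3), ν * ‖fderiv ℝ (u t) y‖ ≤ ε * M ^ 2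

/-- item stmt-NavierStokesRegularity-32322 · support · rank 9 · closed · proved by Summit.NavierStokesRegularity.NavierStokesRegularity.Theorems.RootDecompLiouvilleHorizonLadderTop.smoothingRung_proof (planner) · by planner
[support] TOP RUNG · `SmoothingRung := ∃ ε₀ > 0, HorizonRung ε₀` (lens-5 g10; THEOREM-GRADE: KNSS
L∞-smoothing — tree `knss2009_local_smoothing_holds` (k = 1) + `Theorems.oseen_eq_of_classical`
(Clay-class ⟹ Oseen-mild) + `oseenMild_bounded_unique`; not assembled in the lens file; = N13's base
rung 28921 read on the Liouville side). THE FINITE RANGE AS IT STANDS: the top rung already retires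
a finite Reynolds cell — B1 reduces to the residual beyond R₀ = 1/(8ε₀)
(`exists_beyond_reduces_of_smoothingRung`, kernel); every further rung proved raises R₀; only Q
reaches E♯. BC5 rung of the Q/Q♭ ladder (landable now). Sources: KNSS2009 arXiv:0709.3599 §4; tree
Literature.Analysis.FluidPDE.KNSSLocalSmoothingHolds. -/
@[route_item "route-NavierStokesRegularity-RootDecompLiouvilleHorizon"]
def SmoothingRung : Prop :=
  ∃ ε₀ : ℝ, 0 < ε₀ ∧ ∃ S : ℝ, 0 < S ∧ ∀ (ν T : ℝ), 0 < ν → 0 < T → ∀ (u : ℝ → EuclideanSpace ℝ (Fin 3) → EuclideanSpace ℝ (Fin 3)) (p : ℝ → EuclideanSpace ℝ (Fin 3) → ℝ), Literature.Analysis.FluidPDE.IsClassicalNSSolutionOn (Set.Ico 0 T) ν 0 u p → Literature.Analysis.FluidPDE.IsLerayHopfOn T ν 0 (u 0) u → Literature.Analysis.FluidPDE.HasRapidSpatialDecay (u 0) → ∀ t ∈ Set.Ioo 0 T, ∀ M : ℝ, S * ν ≤ M ^ 2 * t → (∀ s ∈ Set.Ioc 0 t, ∀ y : EuclideanSpace ℝ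 (Fin 3), ‖u s y‖ ≤ M) → ∀ y : EuclideanSpace ℝ (Fin 3), ν * ‖fderiv ℝ (u t) y‖ ≤ ε₀ * M ^ 2

-- `SmoothingRung` holds: proved by `Summit.NavierStokesRegularity.NavierStokesRegularity.Theorems.RootDecompLiouvilleHorizonLadderTop.smoothingRung_proof` (its module imports this route file, so no `_holds` link can be stated here).

/-- item stmt-NavierStokesRegularity-32034 · assembly · rank 1 · open · by planner
[assembly] (L) → B♯ → E♯ → Clay (A); = the deciding theorem `closes` (3/3 binders consumed); support
FR LateRecordsExist (stmt-NavierStokesRegularity-32063, PROVED in the lens) feeds B♯. -/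
@[route_item "route-NavierStokesRegularity-RootDecompLiouvilleHorizon"]
def Assembly : Prop :=
  TypeIliouvilleL → RecordZoomBridge → NoRecordEulerianTypeII → NavierStokesRegularity

/-! D-0027 §2.1 — DECIDING THEOREM (planner-authored via `route open/edit --closes-file`; by planner-decomp-ns-writer-1-g4-0 2026-08-30T11:04:26Z):
its hypotheses are this route's items and its conclusion the sub-problem Statement (glue_lint), and it elaborates with this file. -/

@[closes "route-NavierStokesRegularity-RootDecompLiouvilleHorizon"] theorem closes (hQ : BlowupHorizon) (hG : TypeIGradientFloor) (hR : NoRecordEulerianTypeII)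
    (hK1 : HorizonRecordKill) (hK2 : HorizonTypeIKill) : NavierStokesRegularity := by
  refine Summit.NavierStokesRegularity.NavierStokesRegularity.Theorems.navierStokesRegularity_of_noBlowup ?_
  intro ν T hν hT u p hcl hLH hdec
  by_contra hext
  have hmax : Literature.Analysis.FluidPDE.IsMaximalSmoothSolution ν 0 u p T := ⟨hcl, hext⟩
  exact hK2 hQ hG ν T hν hT u p hmax hLH hdec (hK1 hQ hR ν T hν hT u p hmax hLH hdec)

end Summit.NavierStokesRegularity.NavierStokesRegularity.Theses.RootDecompLiouvilleHorizon
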